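import Literature.NumberTheory.GaloisCohomology.PoitouTateRestrictedRamificationNaturalConsequences
import Literature.NumberTheory.GaloisCohomology.PoitouTateRestrictedRamificationNaturalAt
import HarnessLib

/-!
# Consequences of the POINTWISE natural restricted Poitou–Tate Ш-duality
# `poitouTate_shaRestricted_tateDual_natural_at K S` (Milne I Thm. 4.10 (a) at one set of places)

Theorems only (no definition, no named fact, no `sorry`, no instance).  Topic
`NumberTheory/GaloisCohomology`; namespace `Literature.NumberTheory.GaloisCohomology`.  Cell `bsd-eis`,
background lane «PT-Ш-S-TC» of crux `GoodLatticeBDPValue` (stmt-BirchSwinnertonDyer-19032), LEAD seat;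
`--supports stmt-BirchSwinnertonDyer-19032`.

The lane's END theorem (LEAD RULING #8, halves v32) is the FINITE-`S` pointwise statement
`∀ K [IsTotallyComplex K] (S : Set _), S.Finite → poitouTate_shaRestricted_tateDual_natural_at K S`
(`PoitouTateRestrictedRamificationNaturalAt.lean`).  This file records the one-liners its producer and
its consumers need, at ONE `S`, mirroring `PoitouTateRestrictedRamificationNaturalConsequences.lean`
(which did the same for the all-`S` named fact):

* §1 `finite_and_exists_perfect_shaRestricted_pairing_of_natural_at` — the per-module `ℚ/ℤ`-valued
  duality at `S`; `shaRestricted_tateDual_zmod_of_natural_at` — the per-module `ℤ/n`-valued duality at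
  `S`, i.e. the body of the older fact `poitouTate_shaRestricted_tateDual K` AT `S` (so a finite-`S`
  kernel proof of the pointwise natural form also discharges the per-module form at that `S`);
* §2 `poitouTate_shaRestricted_tateDual_natural_at_of_finset` — the `Set`/`S.Finite` wrapper of a
  `Finset`-indexed proof (the lane's class-formation module `IdeleClassBar.classBarSD K S` is typed for
  `S : Finset`), and the `forall_` packaging `forall_natural_at_of_finset` = literally the END shape;
* §3 `mem_of_prime_dvd_of_natCast_mem` — the support bookkeeping "every place dividing `#M` lies in
  `S` ⇒ every place dividing a prime `ℓ ∣ #M` lies in `S`", which turns the named fact's hypothesis into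
  the per-prime engine hypothesis `S ⊇ S_ℓ` (`DiscreteRep.tateDuality_finite_of_primary`).

HONESTY: no case of Poitou–Tate duality and nothing about BSD is proved here; every statement takes the
pointwise duality as a hypothesis or is bookkeeping.  AI formalisation, weaker than expert review.

## References
* J. S. Milne, *Arithmetic Duality Theorems*, 2nd ed. (2006), I Thm. 4.10 (a) (p. 57), §4 p. 65.
  [MilneADT2006]
* D. Harari, *Galois Cohomology and Class Field Theory*, Universitext (2020), Thm. 17.13 (b) (p. 294).
  [Harari2020]
-/

noncomputable section

open Function NumberField Field IsDedekindDomain CategoryTheory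
open scoped NumberField

namespace Literature.NumberTheory.GaloisCohomology

open Literature.NumberTheory.GaloisRepresentations
open Literature.NumberTheory.GaloisRepresentations.DiscreteGaloisModule (TateDual tateDual
  restrictedCohomology restrictedLocalization shaRestricted)

variable {K : Type} [Field K] [NumberField K]

/-! ## §1 Per-module duality at `S` from the pointwise natural form -/

/-- **The per-module duality at `S`, `ℚ/ℤ`-valued**, from `poitouTate_shaRestricted_tateDual_natural_at K S`:
under the printed hypotheses `Ш¹_S(K, M^D)` and `Ш²_S(K, M)` are finite and perfectly paired into `ℚ/ℤ`.
[cite: MilneADT2006, Ch. I, Thm. 4.10 (a) (p. 57)] [cite: Harari2020, Thm. 17.13 (b) (p. 294)] -/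
theorem finite_and_exists_perfect_shaRestricted_pairing_of_natural_at
    {S : Set (HeightOneSpectrum (𝓞 K))} (h : poitouTate_shaRestricted_tateDual_natural_at K S) (n : ℕ)
    [NeZero n] (M : Type) [AddCommGroup M] [TopologicalSpace M] [DiscreteTopology M] [Finite M]
    (ρ : DiscreteGaloisModule K M) (hn : ∀ m : M, n • m = 0) (hur : GaloisRep.IsUnramifiedOutside S ρ)
    (hS : ∀ v : HeightOneSpectrum (𝓞 K), ((Nat.card M : ℕ) : 𝓞 K) ∈ v.asIdeal → v ∈ S) :
    Finite (shaRestricted (ρ.tateDual n) S 1) ∧ Finite (shaRestricted ρ S 2) ∧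
      ∃ b : ↥(shaRestricted ρ S 2) →+ ↥(shaRestricted (ρ.tateDual n) S 1) →+ AddCircle (1 : ℚ),
        Bijective b ∧ Bijective b.flip := by
  obtain ⟨B, hP, -⟩ := h
  obtain ⟨h1, h2, hb, hb'⟩ := hP n M ρ hn hur hS
  exact ⟨h1, h2, B n M ρ, hb, hb'⟩

/-- **The per-module duality at `S`, `ℤ/n`-valued** (= the body of the older named fact
`poitouTate_shaRestricted_tateDual K` at the set `S`), from the pointwise natural form: the `ℚ/ℤ`-valued
perfect pairing becomes a `ℤ/n`-valued one because `Ш¹_S(K, M^D)` has exponent dividing `n`.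
[cite: MilneADT2006, Ch. I, Thm. 4.10 (a) (p. 57)] [cite: Harari2020, Thm. 17.13 (b) (p. 294)] -/
theorem shaRestricted_tateDual_zmod_of_natural_at
    {S : Set (HeightOneSpectrum (𝓞 K))} (h : poitouTate_shaRestricted_tateDual_natural_at K S) (n : ℕ)
    [NeZero n] (M : Type) [AddCommGroup M] [TopologicalSpace M] [DiscreteTopology M] [Finite M]
    (ρ : DiscreteGaloisModule K M) (hn : ∀ m : M, n • m = 0) (hur : GaloisRep.IsUnramifiedOutside S ρ)
    (hS : ∀ v : HeightOneSpectrum (𝓞 K), ((Nat.card M : ℕ) : 𝓞 K) ∈ v.asIdeal → v ∈ S) :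
    Finite (shaRestricted (ρ.tateDual n) S 1) ∧ Finite (shaRestricted ρ S 2) ∧
      ∃ b : shaRestricted ρ S 2 →+ shaRestricted (ρ.tateDual n) S 1 →+ ZMod n,
        Bijective b ∧ Bijective b.flip := by
  obtain ⟨B, hP, -⟩ := h
  obtain ⟨h1, h2, hb, hb'⟩ := hP n M ρ hn hur hS
  exact ⟨h1, h2, exists_zmod_pairing_of_addCircle_pairing n
    (nsmul_shaRestricted_tateDual_eq_zero ρ S n 1) (B n M ρ) hb hb'⟩

/-! ## §2 The `Finset` → `Set` wrapper (the lane's engine is typed for `S : Finset`) -/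

/-- A proof of the pointwise statement for every FINITE SET OF PLACES GIVEN AS A `Finset` yields it for
every finite `S : Set` (rewrite along `hS.coe_toFinset`). [cite: MilneADT2006, Ch. I, Thm. 4.10 (a) (p. 57)] -/
theorem poitouTate_shaRestricted_tateDual_natural_at_of_finset
    (h : ∀ S' : Finset (HeightOneSpectrum (𝓞 K)),
      poitouTate_shaRestricted_tateDual_natural_at K (↑S' : Set (HeightOneSpectrum (𝓞 K))))
    (S : Set (HeightOneSpectrum (𝓞 K))) (hS : S.Finite) :
    poitouTate_shaRestricted_tateDual_natural_at K S := by
  rw [← hS.coe_toFinset]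
  exact h hS.toFinset

/-- **The END shape of lane «PT-Ш-S-TC» from a per-field `Finset`-indexed proof** (halves v32's
`stub_publishedFactsMore.1`, read with `P := IsTotallyComplex`): if for every number field `K`
satisfying `P K` and every `Finset` of places the pointwise statement holds, then
`∀ K, P K → ∀ S : Set _, S.Finite → poitouTate_shaRestricted_tateDual_natural_at K S`.
[cite: MilneADT2006, Ch. I, Thm. 4.10 (a) (p. 57)] -/
theorem forall_poitouTate_shaRestricted_tateDual_natural_at_of_finset (P : ∀ (K : Type) [Field K] [NumberField K], Prop)
    (h : ∀ (K : Type) [Field K] [NumberField K], P K →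
      ∀ S' : Finset (HeightOneSpectrum (𝓞 K)),
        poitouTate_shaRestricted_tateDual_natural_at K (↑S' : Set (HeightOneSpectrum (𝓞 K)))) :
    ∀ (K : Type) [Field K] [NumberField K], P K →
      ∀ S : Set (HeightOneSpectrum (𝓞 K)), S.Finite → poitouTate_shaRestricted_tateDual_natural_at K S :=
  fun K _ _ hK S hS => poitouTate_shaRestricted_tateDual_natural_at_of_finset (h K hK) S hS

/-! ## §3 Support bookkeeping: `supp #M ⊆ S` gives `S ⊇ S_ℓ` for every prime `ℓ ∣ #M` -/

omit [NumberField K] in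
/-- If every finite place dividing `N` lies in `S` and `ℓ ∣ N`, then every finite place dividing `ℓ` lies
in `S` (`(N) ⊆ (ℓ)` as ideals of `𝓞 K`).  With `N = #M` this turns the hypothesis "order a unit in
`R_{K,S}`" of Milne I 4.10 (a) into the per-prime engine hypothesis `S ⊇ S_ℓ`.
[cite: MilneADT2006, Ch. I, Thm. 4.10 (a) (p. 57: "`M` a finite `G_S`-module whose order is a unit in `R_{K,S}`")] -/
theorem mem_of_prime_dvd_of_natCast_mem {S : Set (HeightOneSpectrum (𝓞 K))} {N ℓ : ℕ}
    (hN : ∀ v : HeightOneSpectrum (𝓞 K), ((N : ℕ) : 𝓞 K) ∈ v.asIdeal → v ∈ S) (hℓ : ℓ ∣ N)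
    (v : HeightOneSpectrum (𝓞 K)) (hv : ((ℓ : ℕ) : 𝓞 K) ∈ v.asIdeal) : v ∈ S := by
  obtain ⟨c, rfl⟩ := hℓ
  exact hN v (by rw [Nat.cast_mul]; exact v.asIdeal.mul_mem_right _ hv)

end Literature.NumberTheory.GaloisCohomology

end
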